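import Literature.Order.WellQuasiOrder.OrthantDecomposition
import Literature.RingTheory.MvPolynomial.HilbertPolynomialExists
import Mathlib.Algebra.Order.Antidiag.FinsuppEquiv
import Mathlib.RingTheory.MvPolynomial.WeightedHomogeneous
import HarnessLib

/-!
# Counting standard monomials by multidegree: eventual polynomiality with non-negative top form

Topic: `Literature/RingTheory/MvPolynomial`. Fix a block structure `blk : Fin n → ι` on the
variables of `K[X_0, …, X_{n-1}]` (`ι` finite), i.e. the multigrading by
`w i = e_{blk i} ∈ ℕ^ι` (Mathlib `Finsupp.weight w`, `w i = Pi.single (blk i) 1`). For an upper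
set `E ⊆ ℕⁿ` of exponents (a monomial ideal) let `c_E(t)`, `t ∈ ℕ^ι`, be the number of exponents
OUTSIDE `E` (standard monomials) of multidegree `t`. Then **`c_E` agrees, for all `t` large in
every coordinate, with a polynomial `P_E ∈ ℚ[T_l : l ∈ ι]` whose coefficients in its top total
degree are all `≥ 0`** (`exists_mvPolynomial_card_standard`). Proof: by the orthant decomposition
`ℕⁿ ∖ E = ⊔_j (a_j + ℕ^{S_j})` (`Literature.Order.WellQuasiOrder.exists_orthantDecomposition`)
it suffices to count one orthant, where the count factors over the blocks (stars and bars,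
Mathlib `Finset.card_finsuppAntidiag_nat_eq_choose`):
`#{x ∈ a + ℕ^S : mdeg x = t} = Π_l binom(s_l + t_l - c_l - 1, t_l - c_l)`, `s_l = |S ∩ blk⁻¹ l|`,
`c_l = mdeg_l a` (`card_filter_orthant_eq_prod`); for `s_l ≥ 1` this is the value at `t` of the
product of the shifted binomial polynomials `(1/(s_l - 1)!) (T_l - c_l + 1) ⋯ (T_l - c_l + s_l - 1)`,
whose only coefficient in total degree `≥ Σ_l (s_l - 1)` is `Π_l 1/(s_l-1)! > 0` at
`T^{s - 1}`; orthants with some `s_l = 0` contribute nothing once `t_l > c_l`; and top forms of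
such polynomials cannot cancel in the sum. This is the multigraded (and positivity-carrying)
version of the tree's `exists_polynomial_card_finsuppAntidiag_filter`
(`HilbertPolynomialExists.lean`), the combinatorial half of the existence of multigraded Hilbert
polynomials with non-negative multidegrees (van der Waerden 1928).

## References

* B. L. van der Waerden, *On Hilbert's function, series of composition of ideals and a
  generalization of the theorem of Bézout*, Proc. Royal Acad. Amsterdam 31 (1928), 749–770.
* R. P. Stanley, *Linear Diophantine equations and local cohomology*, Invent. Math. 68 (1982)
  (Stanley decompositions).
-/

noncomputable section

open Finset MvPolynomial

namespace Literature.RingTheory.MvPolynomial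

variable {ι : Type*} [Fintype ι] [DecidableEq ι] {n : ℕ}

/-! ## The block multidegree -/

omit [Fintype ι] in
/-- The `l`-th component of the block multidegree of an exponent vector `x` is the sum of the
exponents of the variables of block `l`. [folklore] -/
theorem weight_blockWeight_apply (blk : Fin n → ι) (x : Fin n →₀ ℕ) (l : ι) :
    Finsupp.weight (fun i => (Pi.single (blk i) 1 : ι → ℕ)) x l =
      ∑ i ∈ (univ : Finset (Fin n)).filter (fun i => blk i = l), x i := by
  classical
  rw [Finsupp.weight_apply, Finsupp.sum_fintype _ _ (fun i => by simp), Finset.sum_apply,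
    Finset.sum_filter]
  refine Finset.sum_congr rfl fun i _ => ?_
  rw [Pi.smul_apply, smul_eq_mul, Pi.single_apply]
  by_cases h : blk i = l
  · rw [if_pos h.symm, if_pos h, mul_one]
  · rw [if_neg (Ne.symm h), if_neg h, mul_zero]

/-- The total degree is the sum of the block degrees. [folklore] -/
theorem degree_eq_sum_weight_blockWeight (blk : Fin n → ι) (x : Fin n →₀ ℕ) :
    x.degree = ∑ l, Finsupp.weight (fun i => (Pi.single (blk i) 1 : ι → ℕ)) x l := by
  classical
  simp_rw [weight_blockWeight_apply]
  rw [Finset.sum_fiberwise_of_maps_to (fun i _ => Finset.mem_univ (blk i))]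
  change ∑ i ∈ x.support, x i = _
  exact Finset.sum_subset (Finset.subset_univ _) fun i _ hi => Finsupp.notMem_support_iff.mp hi

/-! ## Counting one orthant, block by block -/

/-- **Stars and bars in each block**: the exponents `x` in the orthant `a + ℕ^S`
(`x_i ≥ a_i` for `i ∈ S`, `x_i = a_i` otherwise) of block multidegree `t ≥ mdeg a` correspond to
families `(y_l)_l` of exponents `y_l` supported in `S ∩ blk⁻¹ l` with `|y_l| = t_l - mdeg_l a`
(`x = a + Σ_l y_l`), so their number is `Π_l binom(s_l + (t_l - c_l) - 1, t_l - c_l)` with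
`s_l = |S ∩ blk⁻¹ l|`, `c_l = mdeg_l a` (Mathlib `Finset.card_finsuppAntidiag_nat_eq_choose`).
[folklore] -/
theorem card_filter_orthant_eq_prod (blk : Fin n → ι) (a : Fin n → ℕ) (S : Finset (Fin n))
    (t : ι → ℕ) (ht : ∀ l, ∑ i ∈ (univ : Finset (Fin n)).filter (fun i => blk i = l), a i ≤ t l) :
    (((univ : Finset (Fin n)).finsuppAntidiag (∑ l, t l)).filter (fun x : Fin n →₀ ℕ =>
        (∀ i, (i ∈ S → a i ≤ x i) ∧ (i ∉ S → x i = a i)) ∧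
          Finsupp.weight (fun i => (Pi.single (blk i) 1 : ι → ℕ)) x = t)).card =
      ∏ l, ((S.filter (fun i => blk i = l)).card +
          (t l - ∑ i ∈ (univ : Finset (Fin n)).filter (fun i => blk i = l), a i) - 1).choose
        (t l - ∑ i ∈ (univ : Finset (Fin n)).filter (fun i => blk i = l), a i) := by
  classical
  -- notation-free abbreviations
  set c : ι → ℕ := fun l => ∑ i ∈ (univ : Finset (Fin n)).filter (fun i => blk i = l), a i with hc
  set Y : Finset (ι → (Fin n →₀ ℕ)) :=
    Fintype.piFinset fun l => (S.filter (fun i => blk i = l)).finsuppAntidiag (t l - c l) with hY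
  have hYcard : Y.card = ∏ l, ((S.filter (fun i => blk i = l)).card + (t l - c l) - 1).choose
      (t l - c l) := by
    rw [hY, Fintype.card_piFinset]
    exact Finset.prod_congr rfl fun l _ => Finset.card_finsuppAntidiag_nat_eq_choose _
  rw [← hYcard]
  symm
  -- membership in `Y`, unfolded
  have hYmem : ∀ y : ι → (Fin n →₀ ℕ), y ∈ Y ↔ ∀ l,
      (S.filter (fun i => blk i = l)).sum (y l) = t l - c l ∧
        (y l).support ⊆ S.filter (fun i => blk i = l) := by
    intro y
    simp only [hY, Fintype.mem_piFinset, mem_finsuppAntidiag]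
  have hYzero : ∀ y ∈ Y, ∀ l i, ¬ (i ∈ S ∧ blk i = l) → y l i = 0 := by
    intro y hy l i hi
    by_contra hne
    have hsupp := ((hYmem y).mp hy l).2 (Finsupp.mem_support_iff.mpr hne)
    rw [mem_filter] at hsupp
    exact hi hsupp
  -- the two maps
  refine Finset.card_bij'
    (fun y _ => Finsupp.equivFunOnFinite.symm fun i => a i + y (blk i) i)
    (fun x _ l => Finsupp.equivFunOnFinite.symm fun i =>
      if i ∈ S ∧ blk i = l then x i - a i else 0)
    ?_ ?_ ?_ ?_
  · -- forward map lands in the orthant slice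
    intro y hy
    have hy' := (hYmem y).mp hy
    rw [mem_filter, mem_finsuppAntidiag_univ_iff]
    have hpiece : ∀ i, (i ∈ S → a i ≤ (Finsupp.equivFunOnFinite.symm fun i => a i + y (blk i) i) i) ∧
        (i ∉ S → (Finsupp.equivFunOnFinite.symm fun i => a i + y (blk i) i) i = a i) := by
      intro i
      simp only [Finsupp.coe_equivFunOnFinite_symm]
      refine ⟨fun _ => Nat.le_add_right _ _, fun hi => ?_⟩
      rw [hYzero y hy (blk i) i (fun h => hi h.1), add_zero]
    have hweight : Finsupp.weight (fun i => (Pi.single (blk i) 1 : ι → ℕ))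
        (Finsupp.equivFunOnFinite.symm fun i => a i + y (blk i) i) = t := by
      funext l
      rw [weight_blockWeight_apply]
      simp only [Finsupp.coe_equivFunOnFinite_symm]
      rw [Finset.sum_add_distrib]
      have h1 : ∑ i ∈ (univ : Finset (Fin n)).filter (fun i => blk i = l), y (blk i) i =
          (S.filter (fun i => blk i = l)).sum (y l) := by
        rw [← Finset.sum_subset (s₁ := S.filter (fun i => blk i = l))
          (fun i hi => mem_filter.mpr ⟨mem_univ _, (mem_filter.mp hi).2⟩)
          (fun i hi hi' => by
            rw [(mem_filter.mp hi).2]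
            exact hYzero y hy l i fun h => hi' (mem_filter.mpr ⟨h.1, h.2⟩))]
        exact Finset.sum_congr rfl fun i hi => by rw [(mem_filter.mp hi).2]
      rw [h1, (hy' l).1]
      have hle : c l ≤ t l := ht l
      change c l + (t l - c l) = t l
      omega
    refine ⟨?_, hpiece, hweight⟩
    rw [degree_eq_sum_weight_blockWeight blk, hweight]
  · -- backward map lands in `Y`
    intro x hx
    rw [mem_filter, mem_finsuppAntidiag_univ_iff] at hx
    obtain ⟨-, hpiece, hweight⟩ := hx
    rw [hYmem]
    intro l
    constructor
    · have hw := congr_fun hweight l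
      rw [weight_blockWeight_apply] at hw
      simp only [Finsupp.coe_equivFunOnFinite_symm]
      -- Σ_{S_l} (x - a) = Σ_{block l} x - Σ_{block l} a
      have h2 : ∑ i ∈ S.filter (fun i => blk i = l), (if i ∈ S ∧ blk i = l then x i - a i else 0) =
          ∑ i ∈ (univ : Finset (Fin n)).filter (fun i => blk i = l), (x i - a i) := by
        rw [← Finset.sum_subset (s₁ := S.filter (fun i => blk i = l)) (f := fun i => x i - a i)
          (fun i hi => mem_filter.mpr ⟨mem_univ _, (mem_filter.mp hi).2⟩)
          (fun i hi hi' => by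
            have hiS : i ∉ S := fun h => hi' (mem_filter.mpr ⟨h, (mem_filter.mp hi).2⟩)
            change x i - a i = 0
            rw [(hpiece i).2 hiS, Nat.sub_self])]
        exact Finset.sum_congr rfl fun i hi => by
          rw [if_pos (show i ∈ S ∧ blk i = l from ⟨(mem_filter.mp hi).1, (mem_filter.mp hi).2⟩)]
      rw [h2]
      have hle : ∀ i ∈ (univ : Finset (Fin n)).filter (fun i => blk i = l), a i ≤ x i := by
        intro i _
        by_cases hi : i ∈ S
        · exact (hpiece i).1 hi
        · exact ((hpiece i).2 hi).ge
      have hsum : ∑ i ∈ (univ : Finset (Fin n)).filter (fun i => blk i = l), (x i - a i) +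
          ∑ i ∈ (univ : Finset (Fin n)).filter (fun i => blk i = l), a i =
          ∑ i ∈ (univ : Finset (Fin n)).filter (fun i => blk i = l), x i := by
        rw [← Finset.sum_add_distrib]
        exact Finset.sum_congr rfl fun i hi => Nat.sub_add_cancel (hle i hi)
      simp only [hc]
      omega
    · intro i hi
      rw [Finsupp.mem_support_iff, Finsupp.coe_equivFunOnFinite_symm] at hi
      rw [mem_filter]
      by_contra h
      exact hi (if_neg h)
  · -- backward ∘ forward = id
    intro y hy
    funext l
    ext i
    simp only [Finsupp.coe_equivFunOnFinite_symm]
    by_cases h : i ∈ S ∧ blk i = l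
    · rw [if_pos h, ← h.2, Nat.add_sub_cancel_left]
    · rw [if_neg h, hYzero y hy l i h]
  · -- forward ∘ backward = id
    intro x hx
    rw [mem_filter] at hx
    obtain ⟨-, hpiece, -⟩ := hx
    ext i
    simp only [Finsupp.coe_equivFunOnFinite_symm, and_true]
    by_cases hi : i ∈ S
    · rw [if_pos hi, Nat.add_sub_cancel' ((hpiece i).1 hi)]
    · rw [if_neg hi, add_zero, (hpiece i).2 hi]

/-! ## Products of univariate polynomials in distinct variables -/

section ProdAeval

variable {R : Type*} [CommRing R]

omit [DecidableEq ι] in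
/-- `Π_l X_l^{κ_l}` is the monomial with exponent vector `κ`. [folklore] -/
theorem prod_X_pow_eq_monomial_equivFunOnFinite (κ : ι → ℕ) :
    (∏ l, (X l : MvPolynomial ι R) ^ κ l) = monomial (Finsupp.equivFunOnFinite.symm κ) 1 := by
  rw [MvPolynomial.monomial_eq, C_1, one_mul, Finsupp.prod_fintype _ _ (fun i => pow_zero _)]
  simp only [Finsupp.coe_equivFunOnFinite_symm]

/-- **Coefficients of a product of univariate polynomials in distinct variables**:
`[T^α] Π_l q_l(T_l) = Π_l [T^{α_l}] q_l`. [folklore] -/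
theorem coeff_prod_aeval_X (q : ι → Polynomial R) (α : ι →₀ ℕ) :
    MvPolynomial.coeff α (∏ l, Polynomial.aeval (X l : MvPolynomial ι R) (q l)) =
      ∏ l, (q l).coeff (α l) := by
  classical
  -- a common strict bound on the degrees, above `α` as well
  set N : ℕ := (univ : Finset ι).sup (fun l => (q l).natDegree) + α.degree + 1 with hN
  have hlt : ∀ l, (q l).natDegree < N := fun l => by
    have h := Finset.le_sup (f := fun l => (q l).natDegree) (mem_univ l)
    change (q l).natDegree ≤ (univ : Finset ι).sup (fun l => (q l).natDegree) at h
    omega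
  have hαN : ∀ l, α l < N := fun l => by
    have : α l ≤ α.degree := by
      rw [Finsupp.degree_eq_sum]
      exact Finset.single_le_sum (f := fun i => α i) (fun _ _ => Nat.zero_le _) (mem_univ l)
    omega
  have hexp : (∏ l, Polynomial.aeval (X l : MvPolynomial ι R) (q l)) =
      ∑ κ ∈ Fintype.piFinset (fun _ : ι => range N),
        monomial (Finsupp.equivFunOnFinite.symm κ) (∏ l, (q l).coeff (κ l)) := by
    have h1 : ∀ l, Polynomial.aeval (X l : MvPolynomial ι R) (q l) =
        ∑ k ∈ range N, (q l).coeff k • (X l : MvPolynomial ι R) ^ k := fun l =>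
      Polynomial.aeval_eq_sum_range' (hlt l) _
    simp_rw [h1]
    rw [Finset.prod_univ_sum]
    refine Finset.sum_congr rfl fun κ _ => ?_
    simp_rw [MvPolynomial.smul_eq_C_mul]
    rw [Finset.prod_mul_distrib, ← map_prod, prod_X_pow_eq_monomial_equivFunOnFinite,
      C_mul_monomial, mul_one]
  rw [hexp, coeff_sum]
  simp only [coeff_monomial]
  rw [Finset.sum_eq_single (⇑α : ι → ℕ)]
  · rw [if_pos (Finsupp.equivFunOnFinite_symm_coe α)]
  · intro κ _ hκ
    rw [if_neg]
    intro h
    apply hκ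
    rw [← h]
    rfl
  · intro h
    exfalso
    exact h (Fintype.mem_piFinset.mpr fun l => mem_range.mpr (hαN l))

omit [DecidableEq ι] in
/-- **Values of a product of univariate polynomials in distinct variables.** [folklore] -/
theorem eval_prod_aeval_X (q : ι → Polynomial R) (τ : ι → R) :
    MvPolynomial.eval τ (∏ l, Polynomial.aeval (X l : MvPolynomial ι R) (q l)) =
      ∏ l, (q l).eval (τ l) := by
  rw [map_prod]
  refine Finset.prod_congr rfl fun l _ => ?_
  rw [← MvPolynomial.coe_aeval_eq_eval, RingHom.coe_coe, ← Polynomial.aeval_algHom_apply,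
    MvPolynomial.aeval_X, Polynomial.coe_aeval_eq_eval]

/-- The total degree of `Π_l q_l(T_l)` is at most `Σ_l deg q_l`. [folklore] -/
theorem totalDegree_prod_aeval_X_le (q : ι → Polynomial R) :
    (∏ l, Polynomial.aeval (X l : MvPolynomial ι R) (q l)).totalDegree ≤ ∑ l, (q l).natDegree := by
  classical
  rw [MvPolynomial.totalDegree, Finset.sup_le_iff]
  intro α hα
  rw [MvPolynomial.mem_support_iff, coeff_prod_aeval_X] at hα
  have hle : ∀ l, α l ≤ (q l).natDegree := fun l => by
    by_contra h
    push Not at h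
    exact hα (Finset.prod_eq_zero (mem_univ l) (Polynomial.coeff_eq_zero_of_natDegree_lt h))
  calc (α.sum fun _ e => e) = ∑ l, α l := by
        rw [Finsupp.sum_fintype _ _ (fun _ => rfl)]
    _ ≤ ∑ l, (q l).natDegree := Finset.sum_le_sum fun l _ => hle l

end ProdAeval

/-! ## The shifted binomial polynomials of one block -/

/-- **`binom(s + T - 1, T)` is the value at `T` of the polynomial
`(1/(s-1)!) (X+1)(X+2)⋯(X+s-1)`** for `s ≥ 1` (the number of monomials of degree `T` in `s`
variables; from the tree's `finrank_homogeneousSubmodule_fin` and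
`finrank_homogeneousSubmodule_eq_eval`). [folklore] -/
theorem choose_eq_eval_binomialPolynomial {s : ℕ} (hs : 1 ≤ s) (T : ℕ) :
    (((s + T - 1).choose T : ℕ) : ℚ) =
      (Polynomial.C ((((s - 1).factorial : ℕ) : ℚ)⁻¹) *
        (ascPochhammer ℚ (s - 1)).comp (Polynomial.X + 1)).eval (T : ℚ) := by
  rw [← finrank_homogeneousSubmodule_eq_eval (K := ℚ) s T hs,
    Literature.RingTheory.HilbertSamuel.finrank_homogeneousSubmodule_fin ℚ s T, Nat.add_comm T s]

/-- The shifted binomial polynomial `p_s(X - c)` has degree `s - 1` and leading coefficient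
`1/(s-1)!`. [folklore] -/
theorem natDegree_leadingCoeff_binomialPolynomial_comp (s c : ℕ) :
    ((Polynomial.C ((((s - 1).factorial : ℕ) : ℚ)⁻¹) *
        (ascPochhammer ℚ (s - 1)).comp (Polynomial.X + 1)).comp
          (Polynomial.X - Polynomial.C (c : ℚ))).natDegree = s - 1 ∧
    ((Polynomial.C ((((s - 1).factorial : ℕ) : ℚ)⁻¹) *
        (ascPochhammer ℚ (s - 1)).comp (Polynomial.X + 1)).comp
          (Polynomial.X - Polynomial.C (c : ℚ))).leadingCoeff = ((((s - 1).factorial : ℕ) : ℚ)⁻¹) := by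
  obtain ⟨hdeg, hlc⟩ := natDegree_leadingCoeff_hilbertPolynomial_top s
  constructor
  · rw [Polynomial.natDegree_comp, hdeg, Polynomial.natDegree_X_sub_C, mul_one]
  · rw [Polynomial.leadingCoeff_comp (by rw [Polynomial.natDegree_X_sub_C]; exact one_ne_zero),
      hlc, Polynomial.leadingCoeff_X_sub_C, one_pow, mul_one]

/-! ## The polynomial of one orthant -/

/-- **The count of one orthant is eventually polynomial**: for `t ≥ mdeg a` and all
`s_l = |S ∩ blk⁻¹ l| ≥ 1`, the number of exponents in `a + ℕ^S` of multidegree `t` is the value at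
`t` of `Π_l p_{s_l}(T_l - c_l)`. [folklore] -/
theorem card_filter_orthant_eq_eval (blk : Fin n → ι) (a : Fin n → ℕ) (S : Finset (Fin n))
    (hS : ∀ l, 1 ≤ (S.filter (fun i => blk i = l)).card) (t : ι → ℕ)
    (ht : ∀ l, ∑ i ∈ (univ : Finset (Fin n)).filter (fun i => blk i = l), a i ≤ t l) :
    ((((univ : Finset (Fin n)).finsuppAntidiag (∑ l, t l)).filter (fun x : Fin n →₀ ℕ =>
        (∀ i, (i ∈ S → a i ≤ x i) ∧ (i ∉ S → x i = a i)) ∧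
          Finsupp.weight (fun i => (Pi.single (blk i) 1 : ι → ℕ)) x = t)).card : ℚ) =
      MvPolynomial.eval (fun l => (t l : ℚ)) (∏ l, Polynomial.aeval (X l : MvPolynomial ι ℚ)
        ((Polynomial.C (((((S.filter (fun i => blk i = l)).card - 1).factorial : ℕ) : ℚ)⁻¹) *
          (ascPochhammer ℚ ((S.filter (fun i => blk i = l)).card - 1)).comp (Polynomial.X + 1)).comp
            (Polynomial.X - Polynomial.C
              ((∑ i ∈ (univ : Finset (Fin n)).filter (fun i => blk i = l), a i : ℕ) : ℚ)))) := by
  rw [card_filter_orthant_eq_prod blk a S t ht, Nat.cast_prod, eval_prod_aeval_X]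
  refine Finset.prod_congr rfl fun l _ => ?_
  rw [Polynomial.eval_comp, Polynomial.eval_sub, Polynomial.eval_X, Polynomial.eval_C,
    ← Nat.cast_sub (ht l), ← choose_eq_eval_binomialPolynomial (hS l)]

/-- **Coefficients of the orthant polynomial**: with `s_l ≥ 1` for all `l`, the coefficient of
`T^α` in `Π_l p_{s_l}(T_l - c_l)` is `Π_l 1/(s_l - 1)! > 0` for `α = (s_l - 1)_l`, and `≥ 0`
whenever `|α| ≥ Σ_l (s_l - 1)` (it vanishes unless `α = (s_l - 1)_l`); the total degree is at
most `Σ_l (s_l - 1)`. [folklore] -/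
theorem coeff_orthantPolynomial (s c : ι → ℕ) :
    ((∏ l, Polynomial.aeval (X l : MvPolynomial ι ℚ)
        ((Polynomial.C ((((s l - 1).factorial : ℕ) : ℚ)⁻¹) *
          (ascPochhammer ℚ (s l - 1)).comp (Polynomial.X + 1)).comp
            (Polynomial.X - Polynomial.C (c l : ℚ)))).totalDegree ≤ ∑ l, (s l - 1)) ∧
    (0 < MvPolynomial.coeff (Finsupp.equivFunOnFinite.symm fun l => s l - 1)
      (∏ l, Polynomial.aeval (X l : MvPolynomial ι ℚ)
        ((Polynomial.C ((((s l - 1).factorial : ℕ) : ℚ)⁻¹) *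
          (ascPochhammer ℚ (s l - 1)).comp (Polynomial.X + 1)).comp
            (Polynomial.X - Polynomial.C (c l : ℚ))))) ∧
    (∀ α : ι →₀ ℕ, ∑ l, (s l - 1) ≤ α.degree → 0 ≤ MvPolynomial.coeff α
      (∏ l, Polynomial.aeval (X l : MvPolynomial ι ℚ)
        ((Polynomial.C ((((s l - 1).factorial : ℕ) : ℚ)⁻¹) *
          (ascPochhammer ℚ (s l - 1)).comp (Polynomial.X + 1)).comp
            (Polynomial.X - Polynomial.C (c l : ℚ))))) := by
  classical
  set q : ι → Polynomial ℚ := fun l =>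
    (Polynomial.C ((((s l - 1).factorial : ℕ) : ℚ)⁻¹) *
      (ascPochhammer ℚ (s l - 1)).comp (Polynomial.X + 1)).comp
        (Polynomial.X - Polynomial.C (c l : ℚ)) with hq
  have hdeg : ∀ l, (q l).natDegree = s l - 1 := fun l =>
    (natDegree_leadingCoeff_binomialPolynomial_comp (s l) (c l)).1
  have hlc : ∀ l, (q l).leadingCoeff = ((((s l - 1).factorial : ℕ) : ℚ)⁻¹) := fun l =>
    (natDegree_leadingCoeff_binomialPolynomial_comp (s l) (c l)).2
  change (∏ l, Polynomial.aeval (X l : MvPolynomial ι ℚ) (q l)).totalDegree ≤ _ ∧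
    0 < MvPolynomial.coeff _ (∏ l, Polynomial.aeval (X l : MvPolynomial ι ℚ) (q l)) ∧
    ∀ α : ι →₀ ℕ, _ → 0 ≤ MvPolynomial.coeff α (∏ l, Polynomial.aeval (X l : MvPolynomial ι ℚ) (q l))
  refine ⟨(totalDegree_prod_aeval_X_le q).trans (le_of_eq (Finset.sum_congr rfl fun l _ => hdeg l)),
    ?_, fun α hα => ?_⟩
  · rw [coeff_prod_aeval_X]
    refine Finset.prod_pos fun l _ => ?_
    simp only [Finsupp.coe_equivFunOnFinite_symm]
    rw [← hdeg l, Polynomial.coeff_natDegree, hlc l]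
    exact inv_pos.mpr (by exact_mod_cast Nat.factorial_pos _)
  · rw [coeff_prod_aeval_X]
    by_cases hall : ∀ l, α l ≤ s l - 1
    · -- then `α = (s_l - 1)_l`
      have hsum : ∑ l, α l = ∑ l, (s l - 1) := by
        refine le_antisymm (Finset.sum_le_sum fun l _ => hall l) ?_
        rw [Finsupp.degree_eq_sum] at hα
        exact hα
      have heq : ∀ l, α l = s l - 1 := by
        intro l
        by_contra hne
        have hlt : α l < s l - 1 := lt_of_le_of_ne (hall l) hne
        have : ∑ l, α l < ∑ l, (s l - 1) :=
          Finset.sum_lt_sum (fun l _ => hall l) ⟨l, mem_univ l, hlt⟩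
        omega
      refine le_of_lt (Finset.prod_pos fun l _ => ?_)
      rw [heq l, ← hdeg l, Polynomial.coeff_natDegree, hlc l]
      exact inv_pos.mpr (by exact_mod_cast Nat.factorial_pos _)
    · push Not at hall
      obtain ⟨l, hl⟩ := hall
      rw [Finset.prod_eq_zero (mem_univ l)
        (Polynomial.coeff_eq_zero_of_natDegree_lt (by rw [hdeg l]; exact hl))]

/-! ## Standard monomials of a monomial ideal, counted by multidegree -/

/-- **The number of standard monomials of multidegree `t` is eventually a polynomial in `t` with
non-negative top form.** For an upper set `E` of exponents of `K[X_0, …, X_{n-1}]` with block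
structure `blk : Fin n → ι`, there are `P ∈ ℚ[T_l : l ∈ ι]` and `t₀ ∈ ℕ^ι` such that for all
`t ≥ t₀` (coordinatewise) the number of exponents `x ∉ E` of block multidegree `t` is `P(t)`,
and every coefficient of `P` in total degree `≥ deg P` (i.e. of its top form) is `≥ 0`.
(Orthant decomposition of `ℕⁿ ∖ E`; each orthant with a free direction in every block
contributes `Π_l p_{s_l}(T_l - c_l)`, the others nothing for `t_l > c_l`; the top coefficients
`Π_l 1/(s_l-1)!` are positive, so top forms do not cancel in the sum.) [folklore] -/
theorem exists_mvPolynomial_card_standard (blk : Fin n → ι) (E : Set (Fin n →₀ ℕ))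
    [DecidablePred (· ∈ E)] (hE : IsUpperSet E) :
    ∃ (P : MvPolynomial ι ℚ) (t₀ : ι → ℕ),
      (∀ t : ι → ℕ, t₀ ≤ t →
        ((((univ : Finset (Fin n)).finsuppAntidiag (∑ l, t l)).filter (fun x : Fin n →₀ ℕ =>
            x ∉ E ∧ Finsupp.weight (fun i => (Pi.single (blk i) 1 : ι → ℕ)) x = t)).card : ℚ) =
          MvPolynomial.eval (fun l => (t l : ℚ)) P) ∧
      (∀ α : ι →₀ ℕ, P.totalDegree ≤ α.degree → 0 ≤ P.coeff α) := by
  classical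
  -- orthant decomposition of the complement, transported to `Fin n → ℕ`
  set E' : Set (Fin n → ℕ) := {x | Finsupp.equivFunOnFinite.symm x ∈ E} with hE'
  have hE'up : IsUpperSet E' := by
    intro x x' hxx' hx
    simp only [hE', Set.mem_setOf_eq] at hx ⊢
    exact hE (show Finsupp.equivFunOnFinite.symm x ≤ Finsupp.equivFunOnFinite.symm x' from
      fun i => by simpa using hxx' i) hx
  obtain ⟨κ, instκ, a, S, hmem, huniq⟩ :=
    Literature.Order.WellQuasiOrder.exists_orthantDecomposition n E' hE'up
  have hmemE : ∀ x : Fin n →₀ ℕ, x ∉ E ↔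
      ∃ j, ∀ i, (i ∈ S j → a j i ≤ x i) ∧ (i ∉ S j → x i = a j i) := by
    intro x
    rw [← hmem ⇑x]
    simp only [hE', Set.mem_setOf_eq, Finsupp.equivFunOnFinite_symm_coe]
  -- data of the pieces
  set sz : κ → ι → ℕ := fun j l => ((S j).filter (fun i => blk i = l)).card with hsz
  set c : κ → ι → ℕ := fun j l => ∑ i ∈ (univ : Finset (Fin n)).filter (fun i => blk i = l), a j i
    with hc
  set q : κ → ι → Polynomial ℚ := fun j l =>
    (Polynomial.C ((((sz j l - 1).factorial : ℕ) : ℚ)⁻¹) *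
      (ascPochhammer ℚ (sz j l - 1)).comp (Polynomial.X + 1)).comp
        (Polynomial.X - Polynomial.C (c j l : ℚ)) with hq
  set Pj : κ → MvPolynomial ι ℚ := fun j => ∏ l, Polynomial.aeval (X l : MvPolynomial ι ℚ) (q j l)
    with hPj
  set good : Finset κ := (univ : Finset κ).filter (fun j => ∀ l, 1 ≤ sz j l) with hgood
  refine ⟨∑ j ∈ good, Pj j, fun l => (univ : Finset κ).sup (fun j => c j l) + 1, ?_, ?_⟩
  · -- eventual agreement
    intro t ht
    have hct : ∀ j l, c j l < t l := fun j l => by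
      have h1 := Finset.le_sup (f := fun j => c j l) (mem_univ j)
      have h2 := ht l
      change (univ : Finset κ).sup (fun j => c j l) + 1 ≤ t l at h2
      change c j l ≤ (univ : Finset κ).sup (fun j => c j l) at h1
      omega
    -- the slice of the complement is the disjoint union of the slices of the pieces
    have hunion : ((univ : Finset (Fin n)).finsuppAntidiag (∑ l, t l)).filter (fun x : Fin n →₀ ℕ =>
        x ∉ E ∧ Finsupp.weight (fun i => (Pi.single (blk i) 1 : ι → ℕ)) x = t) =
        (univ : Finset κ).biUnion (fun j =>
          ((univ : Finset (Fin n)).finsuppAntidiag (∑ l, t l)).filter (fun x : Fin n →₀ ℕ =>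
            (∀ i, (i ∈ S j → a j i ≤ x i) ∧ (i ∉ S j → x i = a j i)) ∧
              Finsupp.weight (fun i => (Pi.single (blk i) 1 : ι → ℕ)) x = t)) := by
      ext x
      simp only [mem_filter, mem_biUnion, mem_univ, true_and, hmemE]
      constructor
      · rintro ⟨hdeg, ⟨j, hj⟩, hw⟩
        exact ⟨j, hdeg, hj, hw⟩
      · rintro ⟨j, hdeg, hj, hw⟩
        exact ⟨hdeg, ⟨j, hj⟩, hw⟩
    have hdisj : ((univ : Finset κ) : Set κ).PairwiseDisjoint (fun j =>
        ((univ : Finset (Fin n)).finsuppAntidiag (∑ l, t l)).filter (fun x : Fin n →₀ ℕ =>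
          (∀ i, (i ∈ S j → a j i ≤ x i) ∧ (i ∉ S j → x i = a j i)) ∧
            Finsupp.weight (fun i => (Pi.single (blk i) 1 : ι → ℕ)) x = t)) := by
      intro j _ j' _ hne
      rw [Function.onFun, Finset.disjoint_left]
      intro x hx hx'
      rw [mem_filter] at hx hx'
      exact hne (huniq (⇑x) j j' hx.2.1 hx'.2.1)
    rw [hunion, Finset.card_biUnion hdisj, Nat.cast_sum, map_sum]
    -- good pieces evaluate, bad pieces vanish
    rw [← Finset.sum_filter_add_sum_filter_not (univ : Finset κ) (fun j => ∀ l, 1 ≤ sz j l)]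
    rw [show ∑ j ∈ (univ : Finset κ).filter (fun j => ¬ ∀ l, 1 ≤ sz j l),
        ((((univ : Finset (Fin n)).finsuppAntidiag (∑ l, t l)).filter (fun x : Fin n →₀ ℕ =>
          (∀ i, (i ∈ S j → a j i ≤ x i) ∧ (i ∉ S j → x i = a j i)) ∧
            Finsupp.weight (fun i => (Pi.single (blk i) 1 : ι → ℕ)) x = t)).card : ℚ) = 0 from ?_,
      add_zero]
    · refine Finset.sum_congr rfl fun j hj => ?_
      rw [mem_filter] at hj
      exact card_filter_orthant_eq_eval blk (a j) (S j) hj.2 t (fun l => (hct j l).le)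
    · refine Finset.sum_eq_zero fun j hj => ?_
      rw [mem_filter] at hj
      obtain ⟨l, hl⟩ : ∃ l, sz j l = 0 := by
        by_contra h
        push Not at h
        exact hj.2 fun l => Nat.one_le_iff_ne_zero.mpr (h l)
      rw [Nat.cast_eq_zero, card_filter_orthant_eq_prod blk (a j) (S j) t (fun l => (hct j l).le)]
      refine Finset.prod_eq_zero (mem_univ l) ?_
      change (sz j l + (t l - c j l) - 1).choose (t l - c j l) = 0
      rw [hl]
      have := hct j l
      exact Nat.choose_eq_zero_of_lt (by omega)
  · -- non-negativity of the top form
    intro α hα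
    rcases good.eq_empty_or_nonempty with hge | hgne
    · rw [hge, Finset.sum_empty, coeff_zero]
    -- the piece of largest degree has a positive top coefficient in the sum
    obtain ⟨j₀, hj₀, hmax⟩ := Finset.exists_max_image good (fun j => ∑ l, (sz j l - 1)) hgne
    have hpos : ∀ j ∈ good, ∀ β : ι →₀ ℕ, ∑ l, (sz j l - 1) ≤ β.degree → 0 ≤ (Pj j).coeff β :=
      fun j _ β hβ => (coeff_orthantPolynomial (sz j) (c j)).2.2 β hβ
    have hdegPj : ∀ j, (Pj j).totalDegree ≤ ∑ l, (sz j l - 1) := fun j =>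
      (coeff_orthantPolynomial (sz j) (c j)).1
    set α₀ : ι →₀ ℕ := Finsupp.equivFunOnFinite.symm fun l => sz j₀ l - 1 with hα₀
    have hα₀deg : α₀.degree = ∑ l, (sz j₀ l - 1) := by
      rw [Finsupp.degree_eq_sum]
      simp only [hα₀, Finsupp.coe_equivFunOnFinite_symm]
    have hcoeffpos : 0 < (∑ j ∈ good, Pj j).coeff α₀ := by
      rw [coeff_sum]
      refine lt_of_lt_of_le (coeff_orthantPolynomial (sz j₀) (c j₀)).2.1 ?_
      refine Finset.single_le_sum (f := fun j => (Pj j).coeff α₀) (fun j hj => ?_) hj₀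
      exact hpos j hj α₀ (by rw [hα₀deg]; exact hmax j hj)
    have hdegP : ∑ l, (sz j₀ l - 1) ≤ (∑ j ∈ good, Pj j).totalDegree := by
      have hsupp : α₀ ∈ (∑ j ∈ good, Pj j).support := by
        rw [MvPolynomial.mem_support_iff]
        exact hcoeffpos.ne'
      have h := MvPolynomial.le_totalDegree hsupp
      rw [Finsupp.sum_fintype _ _ (fun _ => rfl)] at h
      simp only [hα₀, Finsupp.coe_equivFunOnFinite_symm] at h
      exact h
    rw [coeff_sum]
    refine Finset.sum_nonneg fun j hj => hpos j hj α ?_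
    exact ((hmax j hj).trans hdegP).trans hα

end Literature.RingTheory.MvPolynomial

end
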